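/-
Copyright (c) 2026 the pub-hodgecm-mathlib formalisation cell (harness21).  Prover seat hodgecm-mathlib-K2E3-p23 (g5), HCML Track B «K2-LIT» ∕ h413
(`stmt-HodgeConjecture-24833`), line `K2_E3_EllipticInputs`, unit U12 «Characters», road «GL-[M6]-sc» (line lead K2E3-p23 (g5), dealer K2E3-plan (g3)),
MEMO «M6sc-BLUEPRINT v4» §1 (ASM): the conjugator shift in the volume count.  2026-09-04.
-/
import Summits.HodgeConjecture.HodgeConjecture.Theorems.K2E3GL3ModUniformizerFundamentalDomain    -- ★ B4-1m F1 p858113 (K2E3-p03 g4): `log_v_det_mul`, `isClopen_preimage_log_v_det`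
import Summits.HodgeConjecture.HodgeConjecture.Theorems.K2E3GLnAdHeightBalls                     -- ★ B4-0 p857992 (K2E3-p14 g5): `adBall_mul`, `isOpen_setOf_adBall`
import Literature.NumberTheory.Automorphic.GLnLocalUnimodular                                      -- ★ `GLn.isMulRightInvariant_of_isHaarMeasure_local`
import HarnessLib

/-!
# Road «GL-[M6]-sc», ASM glue: THE CONJUGATOR SHIFT — `ν{h(det z) ∈ W ∧ 𝔅_R(z) ∧ 𝔅_m(z (yγy⁻¹) z⁻¹)} ≤ ν{h(det z) ∈ W + h(det y) ∧ 𝔅_{R+f}(z) ∧ 𝔅_m(z γ z⁻¹)}`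
# for a conjugator `y` of height `f` (`𝔅_f(y)`)

Cell `pub/hodgecm-mathlib` (D-0151), Track B «K2-LIT», crux H413 = `stmt-HodgeConjecture-24833`, route of record `HCCMUnconditional`.  Lane
`--supports stmt-HodgeConjecture-24833 --as helper`; THEOREMS ONLY (no `def`, no `instance`, no `notation`, no named-fact hypothesis, no `sorry`); count-neutral.

The volume counts ★ V4 `K2E3GL3SplitConjugacyVolume` ∕ ★ VOL-mixed `K2E3GL3MixedConjugacyVolume` are stated at the NORMAL FORM `γ` (diagonal ∕ companion Levi block); the a.e.
element is `g = y γ y⁻¹` with a conjugator `y` whose height `f` Harish-Chandra's Theorem 18 controls (★ `K2E3GL3TruncatedCharSplitTorusRadius`, ★ `K2E3GL3TruncatedCharMixedTorusRadius`: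
`f = 6s + L`).  Right translation `z ↦ z y` (Haar on `GL₃(F)` is right invariant, ★ `GLn.isMulRightInvariant_of_isHaarMeasure_local`) moves the count at `g` into the count at
`γ` with the determinant window shifted by `h(det y)` (★ `log_v_det_mul`) and the radius enlarged by `f` (★ `adBall_mul`) — HC's «`1 + σ(a*) ≤ [1+σ(x)][1+σ((xay₀⁻¹)*)][1+σ(y₀)]`»,
p. 72.  This is where the conjugator height enters the majorant, POLYNOMIALLY through `(2(R+f)+1)²`.
* **`measure_window_adBall_conj_conj_le`** — the shift inequality (any `W : Finset ℤ`, image window `W.image (· + h(det y))` of the same cardinality).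
HONEST LABEL: HC_CM is proved only modulo the 7 printed citations (2 remaining named inputs: hLiu418 = stmt-HodgeConjecture-24832, h413 = stmt-HodgeConjecture-24833) until
rung 0 closes; count-neutral helper, closes no socket.

## References
* [HarishChandra1970] Harish-Chandra (notes by G. van Dijk), *Harmonic Analysis on Reductive p-adic Groups*, LNM 162 (1970), Part VII §3 p. 72.
-/

set_option autoImplicit false
-- the mandated namespace repeats the single-problem summit's segment (`HodgeConjecture.HodgeConjecture`)
set_option linter.dupNamespace false

noncomputable section

open MeasureTheory Measure Set
open scoped MatrixGroups NNReal ENNReal WithZero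
open Literature.NumberTheory.Automorphic Literature.NumberTheory.GaloisRepresentations Literature.NumberTheory.GaloisRepresentations.IsNonarchimedeanLocalField
open Summit.HodgeConjecture.HodgeConjecture.Cruxes.H413.K2E3GLnAdHeightBalls Summit.HodgeConjecture.HodgeConjecture.Cruxes.H413.K2E3GL3ModUniformizerFundamentalDomain

namespace Summit.HodgeConjecture.HodgeConjecture.Cruxes.H413.K2E3GL3ConjugacyCountShift

variable {F : Type*} [Field F] [Valued F ℤᵐ⁰] [ValuativeRel F] [IsNonarchimedeanLocalField F]
  [MeasurableSpace (GL (Fin 3) F)] [BorelSpace (GL (Fin 3) F)]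

/-- **THE CONJUGATOR SHIFT.**  For `ν` right invariant, `y` with `𝔅_f(y)` and any `γ`, window `W` and radii `R, m`:
`ν {z : h(det z) ∈ W ∧ 𝔅_R(z) ∧ 𝔅_m(z (yγy⁻¹) z⁻¹)} ≤ ν {z : h(det z) ∈ W.image (· + h(det y)) ∧ 𝔅_{R+f}(z) ∧ 𝔅_m(z γ z⁻¹)}` (substitute `z ↦ z y`).
[cite: HarishChandra1970, Part VII §3 p. 72] -/
theorem measure_window_adBall_conj_conj_le (ν : Measure (GL (Fin 3) F)) [ν.IsMulRightInvariant] {ϖ : F} {f : ℕ} {y : GL (Fin 3) F}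
    (hy : ∀ i j k l, Valued.v (ϖ ^ f * ((y : Matrix (Fin 3) (Fin 3) F) i j * ((y⁻¹ : GL (Fin 3) F) : Matrix (Fin 3) (Fin 3) F) k l)) ≤ 1)
    (γ : GL (Fin 3) F) (W : Finset ℤ) (R m : ℕ) :
    ν {z : GL (Fin 3) F | WithZero.log (Valued.v (z : Matrix (Fin 3) (Fin 3) F).det) ∈ W ∧
        (∀ i j k l, Valued.v (ϖ ^ R * ((z : Matrix (Fin 3) (Fin 3) F) i j * ((z⁻¹ : GL (Fin 3) F) : Matrix (Fin 3) (Fin 3) F) k l)) ≤ 1) ∧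
        ∀ i j k l, Valued.v (ϖ ^ m * (((z * (y * γ * y⁻¹) * z⁻¹ : GL (Fin 3) F) : Matrix (Fin 3) (Fin 3) F) i j *
          (((z * (y * γ * y⁻¹) * z⁻¹)⁻¹ : GL (Fin 3) F) : Matrix (Fin 3) (Fin 3) F) k l)) ≤ 1} ≤
      ν {z : GL (Fin 3) F | WithZero.log (Valued.v (z : Matrix (Fin 3) (Fin 3) F).det) ∈ W.image (· + WithZero.log (Valued.v (y : Matrix (Fin 3) (Fin 3) F).det)) ∧
        (∀ i j k l, Valued.v (ϖ ^ (R + f) * ((z : Matrix (Fin 3) (Fin 3) F) i j * ((z⁻¹ : GL (Fin 3) F) : Matrix (Fin 3) (Fin 3) F) k l)) ≤ 1) ∧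
        ∀ i j k l, Valued.v (ϖ ^ m * (((z * γ * z⁻¹ : GL (Fin 3) F) : Matrix (Fin 3) (Fin 3) F) i j *
          (((z * γ * z⁻¹)⁻¹ : GL (Fin 3) F) : Matrix (Fin 3) (Fin 3) F) k l)) ≤ 1} := by
  set S₂ : Set (GL (Fin 3) F) := {z : GL (Fin 3) F | WithZero.log (Valued.v (z : Matrix (Fin 3) (Fin 3) F).det) ∈
      W.image (· + WithZero.log (Valued.v (y : Matrix (Fin 3) (Fin 3) F).det)) ∧
      (∀ i j k l, Valued.v (ϖ ^ (R + f) * ((z : Matrix (Fin 3) (Fin 3) F) i j * ((z⁻¹ : GL (Fin 3) F) : Matrix (Fin 3) (Fin 3) F) k l)) ≤ 1) ∧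
      ∀ i j k l, Valued.v (ϖ ^ m * (((z * γ * z⁻¹ : GL (Fin 3) F) : Matrix (Fin 3) (Fin 3) F) i j *
        (((z * γ * z⁻¹)⁻¹ : GL (Fin 3) F) : Matrix (Fin 3) (Fin 3) F) k l)) ≤ 1} with hS₂
  -- the left-hand set lies in the right translate `(· * y) ⁻¹' S₂`
  have hsub : {z : GL (Fin 3) F | WithZero.log (Valued.v (z : Matrix (Fin 3) (Fin 3) F).det) ∈ W ∧
      (∀ i j k l, Valued.v (ϖ ^ R * ((z : Matrix (Fin 3) (Fin 3) F) i j * ((z⁻¹ : GL (Fin 3) F) : Matrix (Fin 3) (Fin 3) F) k l)) ≤ 1) ∧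
      ∀ i j k l, Valued.v (ϖ ^ m * (((z * (y * γ * y⁻¹) * z⁻¹ : GL (Fin 3) F) : Matrix (Fin 3) (Fin 3) F) i j *
        (((z * (y * γ * y⁻¹) * z⁻¹)⁻¹ : GL (Fin 3) F) : Matrix (Fin 3) (Fin 3) F) k l)) ≤ 1} ⊆ (fun z => z * y) ⁻¹' S₂ := by
    rintro z ⟨hW, hR, hm⟩
    refine ⟨?_, ?_, ?_⟩
    · rw [log_v_det_mul]
      exact Finset.mem_image.2 ⟨_, hW, rfl⟩
    · exact adBall_mul hR hy
    · have hgrp : z * y * γ * (z * y)⁻¹ = z * (y * γ * y⁻¹) * z⁻¹ := by group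
      rw [hgrp]
      exact hm
  exact (measure_mono hsub).trans (le_of_eq (measure_preimage_mul_right ν y S₂))

/-- The same, for a Haar measure on `GL₃(F)` (right invariant by unimodularity ★ `GLn.isMulRightInvariant_of_isHaarMeasure_local`). [cite: HarishChandra1970, Part VII §3 p. 72] -/
theorem measure_window_adBall_conj_conj_le_of_isHaarMeasure (ν : Measure (GL (Fin 3) F)) [ν.IsHaarMeasure] {ϖ : F} {f : ℕ} {y : GL (Fin 3) F}
    (hy : ∀ i j k l, Valued.v (ϖ ^ f * ((y : Matrix (Fin 3) (Fin 3) F) i j * ((y⁻¹ : GL (Fin 3) F) : Matrix (Fin 3) (Fin 3) F) k l)) ≤ 1)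
    (γ : GL (Fin 3) F) (W : Finset ℤ) (R m : ℕ) :
    ν {z : GL (Fin 3) F | WithZero.log (Valued.v (z : Matrix (Fin 3) (Fin 3) F).det) ∈ W ∧
        (∀ i j k l, Valued.v (ϖ ^ R * ((z : Matrix (Fin 3) (Fin 3) F) i j * ((z⁻¹ : GL (Fin 3) F) : Matrix (Fin 3) (Fin 3) F) k l)) ≤ 1) ∧
        ∀ i j k l, Valued.v (ϖ ^ m * (((z * (y * γ * y⁻¹) * z⁻¹ : GL (Fin 3) F) : Matrix (Fin 3) (Fin 3) F) i j *
          (((z * (y * γ * y⁻¹) * z⁻¹)⁻¹ : GL (Fin 3) F) : Matrix (Fin 3) (Fin 3) F) k l)) ≤ 1} ≤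
      ν {z : GL (Fin 3) F | WithZero.log (Valued.v (z : Matrix (Fin 3) (Fin 3) F).det) ∈ W.image (· + WithZero.log (Valued.v (y : Matrix (Fin 3) (Fin 3) F).det)) ∧
        (∀ i j k l, Valued.v (ϖ ^ (R + f) * ((z : Matrix (Fin 3) (Fin 3) F) i j * ((z⁻¹ : GL (Fin 3) F) : Matrix (Fin 3) (Fin 3) F) k l)) ≤ 1) ∧
        ∀ i j k l, Valued.v (ϖ ^ m * (((z * γ * z⁻¹ : GL (Fin 3) F) : Matrix (Fin 3) (Fin 3) F) i j *
          (((z * γ * z⁻¹)⁻¹ : GL (Fin 3) F) : Matrix (Fin 3) (Fin 3) F) k l)) ≤ 1} := by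
  haveI : T2Space F := (isLocalField F).toT2Space
  haveI : LocallyCompactSpace F := (isLocalField F).toLocallyCompactSpace
  haveI : IsTopologicalRing F := inferInstance
  haveI : LocallyCompactSpace (Matrix (Fin 3) (Fin 3) F) := inferInstanceAs (LocallyCompactSpace (Fin 3 → Fin 3 → F))
  haveI : LocallyCompactSpace (GL (Fin 3) F) := inferInstance
  haveI : SecondCountableTopology F := secondCountableTopology_localField F
  haveI : SecondCountableTopology (Matrix (Fin 3) (Fin 3) F) := inferInstanceAs (SecondCountableTopology (Fin 3 → Fin 3 → F))
  haveI : SecondCountableTopology (Matrix (Fin 3) (Fin 3) F)ᵐᵒᵖ := MulOpposite.opHomeomorph.symm.secondCountableTopology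
  haveI : SecondCountableTopology (GL (Fin 3) F) := Units.isEmbedding_embedProduct.secondCountableTopology
  haveI := GLn.isMulRightInvariant_of_isHaarMeasure_local 3 F ν
  exact measure_window_adBall_conj_conj_le ν hy γ W R m

/-- The shifted window has the same cardinality. [folklore] -/
theorem card_image_add_right (W : Finset ℤ) (c : ℤ) : (W.image (· + c)).card = W.card :=
  Finset.card_image_of_injective _ (add_left_injective c)

end Summit.HodgeConjecture.HodgeConjecture.Cruxes.H413.K2E3GL3ConjugacyCountShift

end
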